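import Summits.CriticalPhenomena.CardyFormulaZ2.Theorems.CardyFlipRussoVoronoiHubFromSmirnovHybArmCases
import Summits.CriticalPhenomena.CardyFormulaZ2.Theorems.CardyFlipRussoVoronoiHubFromSmirnovHybridStep
import Summits.CriticalPhenomena.CardyFormulaZ2.Theorems.CardyFlipRussoVoronoiHubFromSmirnovOneArmEvents

/-!
# Telescoping over squares (one-arm route, Core A–B; lead c3)

Line `moebius-exact-delaunay-dilation-ward` of crux `VoronoiHubFromSmirnov` (stmt-CriticalPhenomena-6433).

* `symmDiff_subset_biUnion_of_steps`, `abs_measureReal_sub_le_of_steps` — ABSTRACT TELESCOPING: if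
  switching one index at a time moves a set-valued `G S` only inside `Bad i` on a good event, then
  `G ∅` and `G T` differ, on the good event, inside `⋃ i ∈ T, Bad i`, and
  `|μ(G ∅) − μ(G T)| ≤ μ(goodᶜ) + Σ_{i ∈ T} μ(Bad i)` (outer measures throughout: no measurability).
* `hybEvent`, concretely: the chain crossing event for the hybrid adjacency switched on `S`
  (Euclidean `adjEuc W c` / pulled back `adjPull g V δ c`), and `stepBad`: the deterministic
  content of ONE step (landed `hybStep_pivotal` + `chainArm_of_pivotal` + `hybArm_cases`): a defect
  pair in the square AND one of five arm/defect alternatives around it — an event that no longer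
  mentions `S`.
-/

noncomputable section

namespace Summit.CriticalPhenomena.CardyFormulaZ2.Cruxes.VoronoiHubFromSmirnov.MoebiusExactDelaunayDilationWard

open Set MeasureTheory Metric
open scoped symmDiff
open Literature.Analysis.FunctionSpaces
open Literature.Probability.LatticeModels (IsDelaunayPair)

/-! ### Abstract telescoping -/

/-- **Telescoping, set form.**  If for every `S ⊆ T` and `i ∈ T \\ S` the sets `G S` and
`G (insert i S)` differ, inside `good`, only inside `Bad i`, then `G ∅` and `G T` differ, inside
`good`, only inside `⋃ i ∈ T, Bad i`. -/
theorem symmDiff_subset_biUnion_of_steps {Ω ι : Type*} [DecidableEq ι] (T : Finset ι)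
    (G : Finset ι → Set Ω) (good : Set Ω) (Bad : ι → Set Ω)
    (hstep : ∀ S : Finset ι, S ⊆ T → ∀ i ∈ T, i ∉ S → (G S) ∆ (G (insert i S)) ∩ good ⊆ Bad i) :
    (G ∅) ∆ (G T) ∩ good ⊆ ⋃ i ∈ T, Bad i := by
  suffices h : ∀ S : Finset ι, S ⊆ T → (G ∅) ∆ (G S) ∩ good ⊆ ⋃ i ∈ S, Bad i from h T subset_rfl
  intro S
  induction S using Finset.induction_on with
  | empty => intro _; simp [symmDiff_self]
  | @insert i S hiS ih =>
    intro hST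
    have hS : S ⊆ T := (Finset.subset_insert i S).trans hST
    have hi : i ∈ T := hST (Finset.mem_insert_self i S)
    intro c hc
    have htri : c ∈ (G ∅) ∆ (G S) ∪ (G S) ∆ (G (insert i S)) :=
      symmDiff_triangle (G ∅) (G S) (G (insert i S)) hc.1
    rw [Finset.set_biUnion_insert]
    rcases htri with h1 | h2
    · exact Or.inr (ih hS ⟨h1, hc.2⟩)
    · exact Or.inl (hstep S hS i hi hiS ⟨h2, hc.2⟩)

/-- **Telescoping, measure form** (outer measures; no measurability needed): under the step
hypothesis, `|μ(G ∅) − μ(G T)| ≤ μ(goodᶜ) + Σ_{i ∈ T} μ(Bad i)` for a finite measure `μ`. -/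
theorem abs_measureReal_sub_le_of_steps {Ω ι : Type*} [MeasurableSpace Ω] [DecidableEq ι]
    (μ : Measure Ω) [IsFiniteMeasure μ] (T : Finset ι) (G : Finset ι → Set Ω) (good : Set Ω)
    (Bad : ι → Set Ω)
    (hstep : ∀ S : Finset ι, S ⊆ T → ∀ i ∈ T, i ∉ S → (G S) ∆ (G (insert i S)) ∩ good ⊆ Bad i) :
    |μ.real (G ∅) - μ.real (G T)| ≤ μ.real goodᶜ + ∑ i ∈ T, μ.real (Bad i) := by
  have hsub := symmDiff_subset_biUnion_of_steps T G good Bad hstep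
  -- the symmetric difference is small
  have hD : μ.real ((G ∅) ∆ (G T)) ≤ μ.real goodᶜ + ∑ i ∈ T, μ.real (Bad i) := by
    have h1 : (G ∅) ∆ (G T) ⊆ goodᶜ ∪ ((G ∅) ∆ (G T) ∩ good) := by
      intro c hc
      by_cases hg : c ∈ good
      · exact Or.inr ⟨hc, hg⟩
      · exact Or.inl hg
    calc μ.real ((G ∅) ∆ (G T)) ≤ μ.real (goodᶜ ∪ ((G ∅) ∆ (G T) ∩ good)) :=
          measureReal_mono h1
      _ ≤ μ.real goodᶜ + μ.real ((G ∅) ∆ (G T) ∩ good) := measureReal_union_le _ _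
      _ ≤ μ.real goodᶜ + μ.real (⋃ i ∈ T, Bad i) :=
          add_le_add_right (measureReal_mono hsub (measure_ne_top μ _)) _
      _ ≤ μ.real goodᶜ + ∑ i ∈ T, μ.real (Bad i) :=
          add_le_add_right (measureReal_biUnion_finset_le T Bad) _
  -- each set is inside the other up to the symmetric difference
  have hA : μ.real (G ∅) ≤ μ.real (G T) + μ.real ((G ∅) ∆ (G T)) := by
    calc μ.real (G ∅) ≤ μ.real (G T ∪ (G ∅) ∆ (G T)) := by
          refine measureReal_mono fun c hc => ?_
          by_cases h : c ∈ G T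
          · exact Or.inl h
          · exact Or.inr (Or.inl ⟨hc, h⟩)
      _ ≤ μ.real (G T) + μ.real ((G ∅) ∆ (G T)) := measureReal_union_le _ _
  have hB : μ.real (G T) ≤ μ.real (G ∅) + μ.real ((G ∅) ∆ (G T)) := by
    calc μ.real (G T) ≤ μ.real (G ∅ ∪ (G ∅) ∆ (G T)) := by
          refine measureReal_mono fun c hc => ?_
          by_cases h : c ∈ G ∅
          · exact Or.inl h
          · exact Or.inr (Or.inr ⟨hc, h⟩)
      _ ≤ μ.real (G ∅) + μ.real ((G ∅) ∆ (G T)) := measureReal_union_le _ _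
  rw [abs_sub_le_iff]
  constructor <;> linarith

/-! ### The concrete hybrid events and the deterministic content of one step -/

/-- The hybrid chain crossing event: black chains (nuclei of `c.1`, physically in `K`, attached to
`A₀`, `A₂`) for the adjacency switched to the pulled-back one on the squares of `S` (side `u`) and
Euclidean (window `W`) elsewhere. -/
def hybEvent (S : Set (ℤ × ℤ)) (u : ℝ) (W : Set ℂ) (g : ℂ → ℂ) (V : Set ℂ) (δ : ℝ)
    (K A₀ A₂ : Set ℂ) : Set (PointConfig ℂ × PointConfig ℂ) :=
  {c | adjCross (adjHyb S u (adjEuc W c) (adjPull g V δ c)) K A₀ A₂ δ (c.1 : Set ℂ)}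

/-- The deterministic "bad" event of the square `i` for one telescoping step: a defect pair in the
square together with one of the five alternatives of `hybArm_cases` (Euclidean chain arms around
the square avoiding at most one defective cluster, or two separated defective squares in range). -/
def stepBad (T : Finset (ℤ × ℤ)) (u R : ℝ) (W : Set ℂ) (g : ℂ → ℂ) (V : Set ℂ) (δ : ℝ)
    (K : Set ℂ) (i : ℤ × ℤ) : Set (PointConfig ℂ × PointConfig ℂ) :=
  {c | DefSq (adjEuc W c) (adjPull g V δ c) u i K δ (c.1 : Set ℂ) ∧
    (ChainArm (adjEuc W c) (sqCentre u i) (100 * u) R K δ (c.1 : Set ℂ) ∨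
     ChainArm (adjEuc W c) (sqCentre u i) (300 * u) R K δ (c.1 : Set ℂ) ∨
     ChainArm (adjEuc W c) (sqCentre u i) (100 * u) (R - 200 * u) K δ (c.1 : Set ℂ) ∨
     (∃ j ∈ T, DefSq (adjEuc W c) (adjPull g V δ c) u j K δ (c.1 : Set ℂ) ∧
        278 * u ≤ dist (sqCentre u j) (sqCentre u i) ∧
        dist (sqCentre u j) (sqCentre u i) ≤ R - 178 * u ∧
        ChainArm (adjEuc W c) (sqCentre u i) (100 * u)
          (dist (sqCentre u j) (sqCentre u i) - 40 * u) K δ (c.1 : Set ℂ) ∧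
        ChainArm (adjEuc W c) (sqCentre u i) (dist (sqCentre u j) (sqCentre u i) + 40 * u) R K δ
          (c.1 : Set ℂ)) ∨
     (∃ j ∈ T, ∃ j' ∈ T, DefSq (adjEuc W c) (adjPull g V δ c) u j K δ (c.1 : Set ℂ) ∧
        DefSq (adjEuc W c) (adjPull g V δ c) u j' K δ (c.1 : Set ℂ) ∧
        20 * u < dist (sqCentre u j) (sqCentre u j') ∧
        98 * u ≤ dist (sqCentre u j) (sqCentre u i) ∧ dist (sqCentre u j) (sqCentre u i) ≤ R + 2 * u ∧
        98 * u ≤ dist (sqCentre u j') (sqCentre u i) ∧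
        dist (sqCentre u j') (sqCentre u i) ≤ R + 2 * u))}

/-- The "step-good" event: adjacent black nuclei (for either adjacency) physically in `K` are within
`u` (a consequence of the no-void event, proved where the constants are fixed). -/
def stepGood (u : ℝ) (W : Set ℂ) (g : ℂ → ℂ) (V : Set ℂ) (δ : ℝ) (K : Set ℂ) :
    Set (PointConfig ℂ × PointConfig ℂ) :=
  {c | ∀ p q : ℂ, p ∈ (c.1 : Set ℂ) → q ∈ (c.1 : Set ℂ) → (δ : ℂ) * p ∈ K → (δ : ℂ) * q ∈ K →
    (adjEuc W c p q ∨ adjPull g V δ c p q) → dist p q ≤ u}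

/-- Euclidean window adjacency is symmetric (registered glue sub-goal of this module). -/
theorem adjEuc_symm' : ∀ (W : Set ℂ) (c : Literature.Analysis.FunctionSpaces.PointConfig ℂ × Literature.Analysis.FunctionSpaces.PointConfig ℂ) (p q : ℂ), adjEuc W c p q → adjEuc W c q p :=
  fun _ _ _ _ h => IsDelaunayPair.symm h

/-- Euclidean window adjacency is symmetric. -/
theorem adjEuc_symm (W : Set ℂ) (c : PointConfig ℂ × PointConfig ℂ) {p q : ℂ}
    (h : adjEuc W c p q) : adjEuc W c q p :=
  IsDelaunayPair.symm h

/-- Pulled-back adjacency is symmetric. -/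
theorem adjPull_symm (g : ℂ → ℂ) (V : Set ℂ) (δ : ℝ) (c : PointConfig ℂ × PointConfig ℂ)
    {p q : ℂ} (h : adjPull g V δ c p q) : adjPull g V δ c q p :=
  IsDelaunayPair.symm h

/-- Hybrid adjacency of symmetric relations is symmetric. -/
theorem adjHyb_symm {S : Set (ℤ × ℤ)} {u : ℝ} {E₁ E₂ : ℂ → ℂ → Prop}
    (h₁ : ∀ p q, E₁ p q → E₁ q p) (h₂ : ∀ p q, E₂ p q → E₂ q p) {p q : ℂ}
    (h : adjHyb S u E₁ E₂ p q) : adjHyb S u E₁ E₂ q p := by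
  by_cases hs : sqIdx u p ∈ S ∨ sqIdx u q ∈ S
  · exact (adjHyb_of_mem E₁ E₂ hs.symm).2 (h₂ _ _ ((adjHyb_of_mem E₁ E₂ hs).1 h))
  · have hs' : ¬ (sqIdx u q ∈ S ∨ sqIdx u p ∈ S) := fun h' => hs h'.symm
    exact (adjHyb_of_not_mem E₁ E₂ hs').2 (h₁ _ _ ((adjHyb_of_not_mem E₁ E₂ hs).1 h))

/-- **The deterministic content of one telescoping step.**  Squares of side `u > 0`, outer radius
`R > 400u`, far radius `Rfar ≥ R`; every square `i ∈ T` is far (`> Rfar`) from one of the two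
attachment sets; `T` contains the squares of all black nuclei physically in `K`.  Then on the
step-good event, switching the square `i` changes the hybrid chain event only inside `stepBad`. -/
theorem hybEvent_symmDiff_subset_stepBad {T : Finset (ℤ × ℤ)} {u R Rfar : ℝ} {W : Set ℂ}
    {g : ℂ → ℂ} {V : Set ℂ} {δ : ℝ} {K A₀ A₂ : Set ℂ} (hu : 0 < u) (hR : 400 * u < R)
    (hRfar : R ≤ Rfar)
    (hfar : ∀ i ∈ T, (∀ x : ℂ, (δ : ℂ) * x ∈ A₀ → Rfar < dist x (sqCentre u i)) ∨
      (∀ x : ℂ, (δ : ℂ) * x ∈ A₂ → Rfar < dist x (sqCentre u i)))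
    (hT : ∀ p : ℂ, (δ : ℂ) * p ∈ K → sqIdx u p ∈ T) {S : Finset (ℤ × ℤ)} (_hS : S ⊆ T)
    {i : ℤ × ℤ} (hi : i ∈ T) (_hiS : i ∉ S) :
    (hybEvent (↑S : Set (ℤ × ℤ)) u W g V δ K A₀ A₂) ∆
        (hybEvent (↑(insert i S) : Set (ℤ × ℤ)) u W g V δ K A₀ A₂) ∩ stepGood u W g V δ K ⊆
      stepBad T u R W g V δ K i := by
  classical
  rintro c ⟨hc, hgood⟩
  set E₁ : ℂ → ℂ → Prop := adjEuc W c with hE₁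
  set E₂ : ℂ → ℂ → Prop := adjPull g V δ c with hE₂
  set b : Set ℂ := (c.1 : Set ℂ) with hb
  have hcoe : (↑(insert i S) : Set (ℤ × ℤ)) = insert i (↑S : Set (ℤ × ℤ)) := Finset.coe_insert i S
  -- step-good gives the step bound for every hybrid and for `E₁ ∨ E₂`
  have hL : ∀ p q : ℂ, p ∈ b → q ∈ b → (δ : ℂ) * p ∈ K → (δ : ℂ) * q ∈ K → (E₁ p q ∨ E₂ p q) →
      dist p q ≤ u := fun p q hp hq hpK hqK h => hgood p q hp hq hpK hqK h
  have hT' : ∀ p : ℂ, p ∈ b → (δ : ℂ) * p ∈ K → sqIdx u p ∈ T := fun p _ hpK => hT p hpK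
  -- symmetric hybrids
  have hsymm : ∀ S' : Set (ℤ × ℤ), ∀ p q, adjHyb S' u E₁ E₂ p q → adjHyb S' u E₁ E₂ q p :=
    fun S' p q h => adjHyb_symm (fun p q h => adjEuc_symm W c h) (fun p q h => adjPull_symm g V δ c h) h
  -- from the pivotal data of a hybrid `S'`, the five alternatives
  have key : ∀ S' : Finset (ℤ × ℤ),
      adjCross (adjHyb (↑S' : Set (ℤ × ℤ)) u E₁ E₂) K A₀ A₂ δ b →
      ¬ adjCross (adjHyb (↑S' : Set (ℤ × ℤ)) u E₁ E₂) K A₀ A₂ δ (b \ {p | sqIdx u p = i}) →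
      c ∈ stepBad T u R W g V δ K i ∨ ¬ DefSq E₁ E₂ u i K δ b := by
    intro S' hyes hno
    have harm : ChainArm (adjHyb (↑S' : Set (ℤ × ℤ)) u E₁ E₂) (sqCentre u i) u Rfar K δ b :=
      chainArm_of_pivotal _ u Rfar i K A₀ A₂ δ b hu (hsymm _) hyes hno (hfar i hi)
    have hcases := hybArm_cases S' T u R Rfar E₁ E₂ (sqCentre u i) K δ b hu hR hRfar harm hL hT'
    by_cases hdef : DefSq E₁ E₂ u i K δ b
    · left
      exact ⟨hdef, hcases⟩
    · exact Or.inr hdef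
  -- the two cases of the symmetric difference
  have hpiv := hybStep_pivotal (↑S : Set (ℤ × ℤ)) u E₁ E₂ i K A₀ A₂ δ b
  rcases hc with ⟨h1, h2⟩ | ⟨h2, h1⟩
  · -- `c ∈ G S \ G (insert i S)`
    have h2' : ¬ adjCross (adjHyb (insert i (↑S : Set (ℤ × ℤ))) u E₁ E₂) K A₀ A₂ δ b := by
      rwa [← hcoe]
    obtain ⟨hdef, hno⟩ := hpiv.1 h1 h2'
    rcases key S h1 hno with h | h
    · exact h
    · exact absurd hdef h
  · -- `c ∈ G (insert i S) \ G S`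
    have h2' : adjCross (adjHyb (insert i (↑S : Set (ℤ × ℤ))) u E₁ E₂) K A₀ A₂ δ b := by
      rwa [← hcoe]
    obtain ⟨hdef, hno⟩ := hpiv.2 h2' h1
    have hno' : ¬ adjCross (adjHyb (↑(insert i S) : Set (ℤ × ℤ)) u E₁ E₂) K A₀ A₂ δ
        (b \ {p | sqIdx u p = i}) := by rwa [hcoe]
    have hyes' : adjCross (adjHyb (↑(insert i S) : Set (ℤ × ℤ)) u E₁ E₂) K A₀ A₂ δ b := by
      rwa [hcoe]
    rcases key (insert i S) hyes' hno' with h | h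
    · exact h
    · exact absurd hdef h

end Summit.CriticalPhenomena.CardyFormulaZ2.Cruxes.VoronoiHubFromSmirnov.MoebiusExactDelaunayDilationWard

end
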